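import Summits.QuantumFields.QCD.Theorems.TransparentRPWallLabelledConeChainDensitySector

/-!
PROVENANCE.  Strategist-written candidate proof (planner-cstrat-stmt-QuantumFields-9910-r1-0, 2026-08-17; tree copy
`Summits/QuantumFields/QCD/Cruxes/LabelledPlanarSpectralCone/Proof.lean`, 1499 lines, lean check rc 0 / 0 sorries / 0 warnings
against the tree of 2026-08-28), landed VERBATIM in ≤ 400-line parts under `Theorems/` by width seat ym-t4-w17 g0 (free hands):
parts `…LabelledConeDiscSections` (X₁), `…LabelledConeChainDensity{Kinematics,Sector,OneGap,}` (X₂), `…LabelledPlanarSpectralConeSplit`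
(glue), and the by-name closers `…Holds`.  Statements are INLINE (no route import), so these parts are route-independent.
-/

noncomputable section

namespace Summit.QuantumFields.QCD.Theorems.LabelledConeChainDensityProof

open MeasureTheory Complex Set Filter
open scoped InnerProductSpace SchwartzMap ComplexConjugate Topology
open Literature.MathematicalPhysics.QuantumLattice Literature.MathematicalPhysics.AQFT
  Literature.MathematicalPhysics.QuantumFieldTheory
open Summit.QuantumFields.YangMills.Cruxes.PlanarSpectralCone.PositivityDiscToOperatorCone
open Summit.QuantumFields.YangMills.Cruxes.PlanarSpectralCone.PositivityDiscToOperatorCone.OneGap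
open Literature.Analysis.Complex



namespace OneGapL


/-- **The holomorphic `ℋ`-valued stretching, LABELLED.** With `T ≥ 0`, `P` below `T`, `Q` above `T`
and a label string `κ` there is `Ψ̂ : (Fin 1 → ℂ) → ℋ`, holomorphic on
`Ω = {z | 0 < Re z₀, |Im z₀| < Re z₀}`, with `Ψ̂(σ) = Ψ^κ_{P ⊗ Q_{σe₀}}` for every real `σ > 0`. -/
theorem exists_holomorphic_stretch_labelled {ι : Type} (S : LabelledSchwingerFamily ι (EuclideanSpace ℝ (Fin 4)))
    (h : OSReconstructionNoE1 S) {k l : ℕ} (κ : Fin (k + l) → ι)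
    {P : 𝓢((Fin k → (EuclideanSpace ℝ (Fin 4))), ℂ)} {Q : 𝓢((Fin l → (EuclideanSpace ℝ (Fin 4))), ℂ)} {T : ℝ}
    (hP : IsTimeOrdered P) (hQ : IsTimeOrdered Q)
    (hPT : tsupport (P : (Fin k → (EuclideanSpace ℝ (Fin 4))) → ℂ) ⊆ {x | ∀ i, x i 0 < T})
    (hQT : tsupport (Q : (Fin l → (EuclideanSpace ℝ (Fin 4))) → ℂ) ⊆ {x | ∀ i, T < x i 0}) (hT : 0 ≤ T) :
    ∃ Ψv : (Fin 1 → ℂ) → h.Hilbert,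
      DifferentiableOn ℂ Ψv {z : Fin 1 → ℂ | 0 < (z 0).re ∧ |(z 0).im| < (z 0).re} ∧
      ∀ σ : ℝ, ∀ hσ : 0 < σ, Ψv (fun _ => (σ : ℂ)) =
        h.fieldVec (k + l) κ (P.appendTensor (translateMulti (SchwingerFamily.timeVec σ) Q))
          (isTimeOrdered_stretch hP hQ hPT hQT hσ.le) := by
  -- (two elementary geometric facts, inlined; label-free twins exist in the one-species crux module)
  have abs_im_lt_re_of_mem_ball' : ∀ {x : ℝ}, 0 < x → ∀ {w : ℂ},
      w ∈ Metric.ball ((2 * x : ℝ) : ℂ) (Real.sqrt 2 * x) → 0 < w.re ∧ |w.im| < w.re := by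
    intro x hx w hw
    rw [Metric.mem_ball, dist_eq_norm] at hw
    have h2 : ‖w - ((2 * x : ℝ) : ℂ)‖ ^ 2 < (Real.sqrt 2 * x) ^ 2 := by
      exact pow_lt_pow_left₀ hw (norm_nonneg _) two_ne_zero
    rw [mul_pow, Real.sq_sqrt zero_le_two, Complex.sq_norm, Complex.normSq_apply] at h2
    simp only [Complex.sub_re, Complex.ofReal_re, Complex.sub_im, Complex.ofReal_im, sub_zero] at h2
    have hre : 0 < w.re := by nlinarith [sq_nonneg w.im, sq_nonneg (w.re - 2 * x)]
    refine ⟨hre, abs_lt_of_sq_lt_sq ?_ hre.le⟩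
    nlinarith [sq_nonneg (w.re - x)]
  have pair_mem_sectorRegion' : ∀ {w z : ℂ}, (0 < w.re ∧ |w.im| < w.re) → (0 < z.re ∧ |z.im| < z.re) →
      (![w, z] : Fin 2 → ℂ) ∈ Literature.Analysis.Complex.sectorRegion 1 (Real.pi / 2) := by
    intro w z hw hz
    refine ⟨fun j => ?_, ?_⟩
    · fin_cases j
      · simpa using hw.1
      · simpa using hz.1
    · have h := Summit.QuantumFields.YangMills.Cruxes.PlanarSpectralCone.TwoMirrorLightconeSlots.DiscSections.abs_arg_add_abs_arg_lt hw.1 hz.1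
        (mul_lt_mul'' hw.2 hz.2 (abs_nonneg _) (abs_nonneg _))
      rw [Fin.sum_univ_two]
      simpa using h
  obtain ⟨G, hGd, hGr⟩ := exists_sector_extension_labelled S h κ hP hQ hPT hQT hT
  have hFto : ∀ σ : ℝ, IsTimeOrdered (P.appendTensor (translateMulti (SchwingerFamily.timeVec (max σ 0)) Q)) :=
    fun σ => isTimeOrdered_stretch hP hQ hPT hQT (le_max_right σ 0)
  set W : ℝ → h.Hilbert := fun σ => h.fieldVec (k + l) κ
    (P.appendTensor (translateMulti (SchwingerFamily.timeVec (max σ 0)) Q)) (hFto σ) with hW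
  set Ω : Set (Fin 1 → ℂ) := {z | 0 < (z 0).re ∧ |(z 0).im| < (z 0).re} with hΩ
  have hmain := exists_holomorphic_gramVec (m := 1) (H := h.Hilbert) (Ω := Ω)
    (k := fun w z => G ![w 0, z 0]) (Φ := fun η => W (η 0)) ?_ ?_
  · obtain ⟨Ψv, hΨd, hΨr, -, -⟩ := hmain
    refine ⟨Ψv, hΨd, fun σ hσ => ?_⟩
    have hmem : (fun _ : Fin 1 => ((σ : ℝ) : ℂ)) ∈ Ω := by
      refine ⟨by simpa using hσ, ?_⟩
      simpa using hσ
    have := hΨr (fun _ => σ) hmem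
    rw [this, hW]
    exact fieldVec_congr h _ (by rw [max_eq_left hσ.le]) _ _
  · -- every point of `Ω` lies in a real-centred disc inside `Ω` on whose square `k` is holomorphic
    intro z hz
    obtain ⟨hx, hy⟩ := hz
    set x : ℝ := (z 0).re with hxdef
    refine ⟨fun _ => 2 * x, fun _ => Real.sqrt 2 * x, ?_, fun _ => by positivity, ?_, ?_⟩
    · rw [mem_polydisc]
      intro i
      rw [show i = 0 from Subsingleton.elim i 0, Metric.mem_ball, dist_eq_norm]
      have h2 : ‖z 0 - ((2 * x : ℝ) : ℂ)‖ ^ 2 < (Real.sqrt 2 * x) ^ 2 := by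
        rw [mul_pow, Real.sq_sqrt zero_le_two, Complex.sq_norm, Complex.normSq_apply]
        simp only [Complex.sub_re, Complex.ofReal_re, Complex.sub_im, Complex.ofReal_im, sub_zero]
        have hy' := abs_lt.1 hy
        nlinarith
      exact lt_of_pow_lt_pow_left₀ 2 (by positivity) h2
    · intro w hw
      rw [mem_polydisc] at hw
      exact abs_im_lt_re_of_mem_ball' hx (hw 0)
    · have hlin : Differentiable ℂ (fun p : (Fin 1 → ℂ) × (Fin 1 → ℂ) => (![p.1 0, p.2 0] : Fin 2 → ℂ)) := by
        refine differentiable_pi.2 fun j => ?_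
        have h1 : Differentiable ℂ fun p : (Fin 1 → ℂ) × (Fin 1 → ℂ) => p.1 0 :=
          (ContinuousLinearMap.proj (R := ℂ) (φ := fun _ : Fin 1 => ℂ) 0).differentiable.comp differentiable_fst
        have h2 : Differentiable ℂ fun p : (Fin 1 → ℂ) × (Fin 1 → ℂ) => p.2 0 :=
          (ContinuousLinearMap.proj (R := ℂ) (φ := fun _ : Fin 1 => ℂ) 0).differentiable.comp differentiable_snd
        fin_cases j
        · simpa using h1
        · simpa using h2
      refine hGd.comp hlin.differentiableOn fun p hp => ?_
      rw [Set.mem_prod, mem_polydisc, mem_polydisc] at hp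
      exact pair_mem_sectorRegion' (abs_im_lt_re_of_mem_ball' hx (hp.1 0)) (abs_im_lt_re_of_mem_ball' hx (hp.2 0))
  · -- the Gram identity at the real points of `Ω`
    intro η η' hη hη'
    have h0 : 0 < η 0 := by simpa using hη.1
    have h0' : 0 < η' 0 := by simpa using hη'.1
    have hvec : (fun j => (((![η' 0, η 0] : Fin 2 → ℝ) j : ℝ) : ℂ)) = (![((η' 0 : ℝ) : ℂ), ((η 0 : ℝ) : ℂ)] : Fin 2 → ℂ) := by
      funext j; fin_cases j <;> simp
    have hpos : ∀ j, 0 < (![η' 0, η 0] : Fin 2 → ℝ) j := fun j => by fin_cases j <;> simpa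
    show ⟪W (η' 0), W (η 0)⟫_ℂ = G ![((η' 0 : ℝ) : ℂ), ((η 0 : ℝ) : ℂ)]
    rw [← hvec, hGr _ hpos]
    simp only [Matrix.cons_val_zero, Matrix.cons_val_one, Matrix.cons_val_fin_one]
    have e1 : W (η' 0) = h.fieldVec (k + l) κ
        (P.appendTensor (translateMulti (SchwingerFamily.timeVec (η' 0)) Q))
        (isTimeOrdered_stretch hP hQ hPT hQT h0'.le) :=
      fieldVec_congr h _ (by rw [max_eq_left h0'.le]) _ _
    have e2 : W (η 0) = h.fieldVec (k + l) κ
        (P.appendTensor (translateMulti (SchwingerFamily.timeVec (η 0)) Q))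
        (isTimeOrdered_stretch hP hQ hPT hQT h0.le) :=
      fieldVec_congr h _ (by rw [max_eq_left h0.le]) _ _
    rw [e1, e2, inner_fieldVec_fieldVec']

/-- The one-gap conclusion for `T ≥ 0`, labelled. -/
theorem inner_stretch_eq_zero_labelled {ι : Type} (S : LabelledSchwingerFamily ι (EuclideanSpace ℝ (Fin 4)))
    (h : OSReconstructionNoE1 S) {k l : ℕ} (κ : Fin (k + l) → ι)
    {P : 𝓢((Fin k → (EuclideanSpace ℝ (Fin 4))), ℂ)} {Q : 𝓢((Fin l → (EuclideanSpace ℝ (Fin 4))), ℂ)} {T : ℝ}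
    (hP : IsTimeOrdered P) (hQ : IsTimeOrdered Q)
    (hPT : tsupport (P : (Fin k → (EuclideanSpace ℝ (Fin 4))) → ℂ) ⊆ {x | ∀ i, x i 0 < T})
    (hQT : tsupport (Q : (Fin l → (EuclideanSpace ℝ (Fin 4))) → ℂ) ⊆ {x | ∀ i, T < x i 0}) (hT : 0 ≤ T)
    (χ : h.Hilbert) (s₀ : ℝ)
    (hχ : ∀ s : ℝ, s₀ ≤ s → 0 ≤ s →
      ∀ hs : IsTimeOrdered (P.appendTensor (translateMulti (SchwingerFamily.timeVec s) Q)),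
        ⟪χ, h.fieldVec (k + l) κ _ hs⟫_ℂ = 0)
    (s : ℝ) (hs0 : 0 ≤ s)
    (hs : IsTimeOrdered (P.appendTensor (translateMulti (SchwingerFamily.timeVec s) Q))) :
    ⟪χ, h.fieldVec (k + l) κ _ hs⟫_ℂ = 0 := by
  obtain ⟨Ψv, hΨd, hΨr⟩ := exists_holomorphic_stretch_labelled S h κ hP hQ hPT hQT hT
  -- the scalar function `g ζ = ⟪χ, Ψ̂ ζ⟫` on `U = {0 < Re ζ, |Im ζ| < Re ζ}`
  set U : Set ℂ := {ζ : ℂ | 0 < ζ.re ∧ |ζ.im| < ζ.re} with hU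
  set g : ℂ → ℂ := fun ζ => ⟪χ, Ψv (fun _ => ζ)⟫_ℂ with hg
  have hUo : IsOpen U :=
    (isOpen_lt continuous_const Complex.continuous_re).inter
      (isOpen_lt (continuous_abs.comp Complex.continuous_im) Complex.continuous_re)
  have hUc : Convex ℝ U := by
    have e : U = {ζ : ℂ | 0 < ζ.re} ∩ ({ζ : ℂ | ζ.im - ζ.re < 0} ∩ {ζ : ℂ | -ζ.im - ζ.re < 0}) := by
      ext ζ
      simp only [hU, Set.mem_setOf_eq, Set.mem_inter_iff, abs_lt]
      constructor
      · rintro ⟨h1, h2, h3⟩; exact ⟨h1, by linarith, by linarith⟩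
      · rintro ⟨h1, h2, h3⟩; exact ⟨h1, by linarith, by linarith⟩
    rw [e]
    refine (convex_halfSpace_re_gt 0).inter ((convex_halfSpace_lt ?_ 0).inter (convex_halfSpace_lt ?_ 0))
    · exact ⟨fun x y => by simp only [Complex.add_im, Complex.add_re]; ring,
        fun c x => by simp only [Complex.real_smul, Complex.mul_im, Complex.mul_re, Complex.ofReal_re,
          Complex.ofReal_im, zero_mul, sub_zero, add_zero, smul_eq_mul]; ring⟩
    · exact ⟨fun x y => by simp only [Complex.add_im, Complex.add_re, neg_add]; ring,
        fun c x => by simp only [Complex.real_smul, Complex.mul_im, Complex.mul_re, Complex.ofReal_re,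
          Complex.ofReal_im, zero_mul, sub_zero, add_zero, smul_eq_mul]; ring⟩
  have hgd : DifferentiableOn ℂ g U := by
    have h1 : DifferentiableOn ℂ (fun ζ : ℂ => Ψv (fun _ => ζ)) U := by
      refine hΨd.comp (differentiableOn_pi.2 fun _ => differentiableOn_id) fun ζ hζ => ?_
      exact hζ
    exact (innerSL ℂ χ).differentiable.comp_differentiableOn h1
  -- `g` vanishes at the real points `> max s₀ 0`
  have hg0 : ∀ σ : ℝ, max s₀ 0 < σ → g σ = 0 := by
    intro σ hσ
    have hσ0 : 0 < σ := lt_of_le_of_lt (le_max_right _ _) hσ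
    show ⟪χ, Ψv (fun _ => (σ : ℂ))⟫_ℂ = 0
    rw [hΨr σ hσ0]
    exact hχ σ ((le_max_left _ _).trans hσ.le) hσ0.le _
  -- hence on `U` (identity theorem along `z₀ + 1/(n+1)`, `z₀ = max s₀ 0 + 1`)
  set z₀ : ℝ := max s₀ 0 + 1 with hz₀
  have hz₀0 : 0 < z₀ := by have := le_max_right s₀ 0; linarith
  have hz₀U : ((z₀ : ℝ) : ℂ) ∈ U := ⟨by simpa using hz₀0, by simpa using hz₀0⟩
  have hfreq : ∃ᶠ ζ in 𝓝[≠] ((z₀ : ℝ) : ℂ), g ζ = 0 := by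
    refine ((tendsto_ofReal_add_inv_nhdsWithin z₀).frequently
      ((Eventually.of_forall fun n => ?_).frequently))
    show g ((z₀ + 1 / ((n : ℝ) + 1) : ℝ) : ℂ) = 0
    have hpos : (0 : ℝ) < 1 / ((n : ℝ) + 1) := by positivity
    exact hg0 _ (by linarith)
  have hgU : EqOn g 0 U :=
    (hgd.analyticOnNhd hUo).eqOn_zero_of_preconnected_of_frequently_eq_zero hUc.isPreconnected hz₀U hfreq
  -- conclusion for `s > 0`
  have hpos : ∀ σ : ℝ, ∀ hσ : 0 < σ,
      ⟪χ, h.fieldVec (k + l) κ (P.appendTensor (translateMulti (SchwingerFamily.timeVec σ) Q))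
        (isTimeOrdered_stretch hP hQ hPT hQT hσ.le)⟫_ℂ = 0 := by
    intro σ hσ
    have h1 := hgU (⟨by simpa using hσ, by simpa using hσ⟩ : ((σ : ℝ) : ℂ) ∈ U)
    simp only [hg, Pi.zero_apply] at h1
    rwa [hΨr σ hσ] at h1
  rcases hs0.eq_or_lt with hs0' | hs0'
  · -- `s = 0`: continuity of the stretching at `0`
    subst hs0'
    have hlim : Tendsto (fun n : ℕ => P.appendTensor (translateMulti (SchwingerFamily.timeVec (1 / ((n : ℝ) + 1))) Q))
        atTop (𝓝 (P.appendTensor (translateMulti (SchwingerFamily.timeVec 0) Q))) :=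
      ((continuous_stretch P Q).tendsto 0).comp tendsto_one_div_add_atTop_nhds_zero_nat
    have ht := tendsto_fieldVec h κ (fun n : ℕ => isTimeOrdered_stretch hP hQ hPT hQT
      (by positivity : (0 : ℝ) ≤ 1 / ((n : ℝ) + 1))) hs hlim
    have ht' : Tendsto (fun n : ℕ => ⟪χ, h.fieldVec (k + l) κ
        (P.appendTensor (translateMulti (SchwingerFamily.timeVec (1 / ((n : ℝ) + 1))) Q))
        (isTimeOrdered_stretch hP hQ hPT hQT (by positivity : (0 : ℝ) ≤ 1 / ((n : ℝ) + 1)))⟫_ℂ)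
        atTop (𝓝 ⟪χ, h.fieldVec (k + l) κ
          (P.appendTensor (translateMulti (SchwingerFamily.timeVec 0) Q)) hs⟫_ℂ) :=
      (tendsto_const_nhds (x := χ)).inner ht
    have h0 : Tendsto (fun n : ℕ => ⟪χ, h.fieldVec (k + l) κ
        (P.appendTensor (translateMulti (SchwingerFamily.timeVec (1 / ((n : ℝ) + 1))) Q))
        (isTimeOrdered_stretch hP hQ hPT hQT (by positivity : (0 : ℝ) ≤ 1 / ((n : ℝ) + 1)))⟫_ℂ)
        atTop (𝓝 0) := by
      have : ∀ n : ℕ, ⟪χ, h.fieldVec (k + l) κ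
          (P.appendTensor (translateMulti (SchwingerFamily.timeVec (1 / ((n : ℝ) + 1))) Q))
          (isTimeOrdered_stretch hP hQ hPT hQT (by positivity : (0 : ℝ) ≤ 1 / ((n : ℝ) + 1)))⟫_ℂ = 0 :=
        fun n => hpos _ (by positivity)
      simp only [this]
      exact tendsto_const_nhds
    exact tendsto_nhds_unique ht' h0
  · exact hpos s hs0'

/-- **ONE GAP, labelled** (the registered stub of the birth skeleton): for `P` (`k` points, times
`< T`) and `Q` (`l` points, times `> T`) time-ordered and `Ψ(s) = Ψ^κ_{P ⊗ Q_{s e₀}}`, if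
`χ ⊥ Ψ(s)` for all `s ≥ s₀` then `χ ⊥ Ψ(s)` for all `s ≥ 0`. Proof: replace `T` by `max T 0`. -/
theorem oneGap_labelled {ι : Type} (S : LabelledSchwingerFamily ι (EuclideanSpace ℝ (Fin 4))) (h : OSReconstructionNoE1 S)
    {k l : ℕ} (κ : Fin (k + l) → ι) (P : 𝓢((Fin k → (EuclideanSpace ℝ (Fin 4))), ℂ)) (Q : 𝓢((Fin l → (EuclideanSpace ℝ (Fin 4))), ℂ)) (T : ℝ)
    (hP : IsTimeOrdered P) (hQ : IsTimeOrdered Q)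
    (hPT : tsupport (P : (Fin k → (EuclideanSpace ℝ (Fin 4))) → ℂ) ⊆ {x | ∀ i, x i 0 < T})
    (hQT : tsupport (Q : (Fin l → (EuclideanSpace ℝ (Fin 4))) → ℂ) ⊆ {x | ∀ i, T < x i 0})
    (χ : h.Hilbert) (s₀ : ℝ)
    (hχ : ∀ s : ℝ, s₀ ≤ s → 0 ≤ s →
      ∀ hs : IsTimeOrdered (P.appendTensor (translateMulti (SchwingerFamily.timeVec s) Q)),
        ⟪χ, h.fieldVec (k + l) κ _ hs⟫_ℂ = 0)
    (s : ℝ) (hs0 : 0 ≤ s)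
    (hs : IsTimeOrdered (P.appendTensor (translateMulti (SchwingerFamily.timeVec s) Q))) :
    ⟪χ, h.fieldVec (k + l) κ _ hs⟫_ℂ = 0 := by
  have hPT' : tsupport (P : (Fin k → (EuclideanSpace ℝ (Fin 4))) → ℂ) ⊆ {x | ∀ i, x i 0 < max T 0} :=
    fun x hx i => (hPT hx i).trans_le (le_max_left _ _)
  have hQT' : tsupport (Q : (Fin l → (EuclideanSpace ℝ (Fin 4))) → ℂ) ⊆ {x | ∀ i, max T 0 < x i 0} :=
    fun x hx i => max_lt (hQT hx i) ((hQ hx).1 i)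
  exact inner_stretch_eq_zero_labelled S h κ hP hQ hPT' hQT' (le_max_right _ _) χ s₀ hχ s hs0 hs


end OneGapL

end Summit.QuantumFields.QCD.Theorems.LabelledConeChainDensityProof

end
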